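import Summits.QuantumFields.BalabanUV.Beta.MultiscaleGradientSource
import Summits.QuantumFields.BalabanUV.Beta.AccretiveCombesThomasSandwichSite

/-!
# Beta / MultiscaleGradientSourceLocal — the owner's file 19a bricks (α) and (β₁) with the sup hypothesis LOCALIZED to the
# `d_n`-ball of radius `4d+1` about the evaluation site: `abs_le_on_unit_ball_loc`, `abs_levelSum_le_on_unit_ball_loc` — so that the
# gradient member can be assembled for the LOCAL Dirichlet inverses, whose sup member (this lineage's «17-Dirichlet»
# `MultiscaleSupMemberDirichlet.real_sup_dirInv_le`) holds at INTERIOR points only (brick (b) of the (w4-d)-flat programme; MODEL)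

WHAT IS CERTIFIED (kernel, 0 sorry).  File 19a's statements and proofs VERBATIM except that `hsup` is assumed only for `d_n(q₁, x) ≤ 4d+1`:
(α) reads it at the point `(y,j)` of the unit ball (`1 ≤ 4d+1`); (β₁) reads it on the CELL of `y`, whose sites are within `4d` of `y` (two corner
thresholds of K4 `sdist_corner_thresholds`) hence within `4d+1` of `x`.  Nothing else changes (constants identical).
(unit `b2b-balaban-beta-d4-p2`, GEN 11, MODEL crew; journal l.25223; consumer: «19b-Dirichlet».)

HONEST FRAMING: discharging `BetaPertH` makes Bałaban's UV stability UNCONDITIONAL — NOT the continuum limit, NOT the Clay problem.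
HONEST DEPENDENCY (verbatim): «continuum YM on T⁴ ⇐ BetaPertH ∧ nine spine estimates (0/9 proved); BetaPertH ⇐ (D1) ∧ (D4) ∧ CAP+tail;
G-an2-4 gates asym, D1 and NE2/3/4.»  THIS MODULE DISCHARGES NOTHING of `BetaPertH`, asserts NOTHING printed and cites nothing as a fact
(ABSOLUTE RULE): [folklore] bookkeeping about the MODEL operator (the owner's proofs, localized); nothing of Bałaban's G′(U).  LOCATORS (shape only):
[Balaban1985BackgroundPropagators] (3.16) p. 393, Thm 3.1 (3.42) p. 397.  No class change on row D4 (critical-path width 0; D4 DISCHARGE NO DATE);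
NOT BetaPertH, NOT continuum, NOT Clay, NOT summit progress.
-/

open scoped BigOperators
open Finset

namespace Summit.QuantumFields.BalabanUV.Beta.MultiscaleGradientSourceLocal

open Summit.QuantumFields.BalabanUV.Beta.BoxPoincare (Box)
open Summit.QuantumFields.BalabanUV.Beta.MultiscaleCoerciveTorus
open Summit.QuantumFields.BalabanUV.Beta.MultiscaleDistance
open Summit.QuantumFields.BalabanUV.Beta.MultiscaleDistanceMetric (sdist_comm sdist_triangle_torus)
open Summit.QuantumFields.BalabanUV.Beta.MultiscaleDistanceGraded (scale_le_scale_mul_exp_add)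
open Summit.QuantumFields.BalabanUV.Beta.MultiscaleDecayBudget
open Summit.QuantumFields.BalabanUV.Beta.MultiscaleSupMemberBall (card_cellCp_le)
open Summit.QuantumFields.BalabanUV.Beta.MultiscaleAveragingPointwise (abs_levelSum_apply_le)
open Summit.QuantumFields.BalabanUV.Beta.MultiscaleRegularitySource (cell_in_ball)
open Summit.QuantumFields.BalabanUV.Beta.MultiscaleGradientSource (scale_le_on_unit_ball)
open Summit.QuantumFields.BalabanUV.Beta.AccretiveCombesThomasSandwichSite (sdist_corner_thresholds)
open Literature.MathematicalPhysics.QuantumFieldTheory.Balaban1983to89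
open Literature.MathematicalPhysics.QuantumFieldTheory.Balaban1983to89.B9Thm37GluePU (bsrc btgt)
open Literature.MathematicalPhysics.QuantumFieldTheory.Balaban1983to89.B9Thm37GlueTorusCov (tblk)
open Literature.MathematicalPhysics.QuantumFieldTheory.Balaban1983to89.B9Thm37GlueTorusCovLevels (levelSum)
open B5TorusCover (UT Ctr ctrU)

noncomputable section

variable {d : ℕ} {N : Fin d → ℕ} [∀ i, NeZero (N i)]

section Ball

variable [NeZero d] {J K : Type} [Fintype J] [Fintype K] [DecidableEq K] (S : J → ℕ) (hS : ∀ l, 1 ≤ S l)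
  (hdivS : ∀ l i, S l ∣ N i) (lvl : K → J) (zc : (k : K) → Ctr N (S (lvl k)))
  (hcover : ∀ x : UT N, ∃ k, ∃ v : Box d (S (lvl k)), cellPt S hS hdivS lvl zc k v = x)
  {L : ℕ} (hL : 1 ≤ L) (e : J → ℕ) (hSe : ∀ l, S l = L ^ e l) {R : ℝ} (hR : 0 < R) {A : ℕ}
  (hadd : ∀ x y : UT N, |(e (lvl (cellOf S hS hdivS lvl zc hcover x)) : ℝ) - e (lvl (cellOf S hS hdivS lvl zc hcover y))| ≤
    A + sdist bsrc btgt (siteScale S hS hdivS lvl zc hcover) x y / R)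

include hL e hSe hR hadd


omit [NeZero d] [Fintype J] [Fintype K] [DecidableEq K] in
/-- **(α, localized) A sup bound of the shape `|f(q)| ≤ 𝔅·n(q)²·e^{−δd_n(q,t)}·m` read on the `d_n`-ball of radius 1 around `x` in the
currency of the centre**: `|f(y,j)| ≤ 𝔅Γ²e^{δ}·n(x)²·e^{−δd_n(x,t)}·m` for `d_n(y,x) ≤ 1` (scale comparison + triangle inequality). [folklore] -/
theorem abs_le_on_unit_ball_loc {Cp : Type} {Γ : ℝ} (hΓ : Γ = (L : ℝ) ^ A * Real.exp (Real.log L / R * (4 * d + 1)))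
    {δ 𝔅 m : ℝ} (hδ0 : 0 ≤ δ) (h𝔅0 : 0 ≤ 𝔅) (hm : 0 ≤ m) (f : UT N × Cp → ℝ) (t : UT N)
    {x : UT N}
    (hsup : ∀ q : UT N × Cp, sdist bsrc btgt (siteScale S hS hdivS lvl zc hcover) q.1 x ≤ 4 * d + 1 →
      |f q| ≤ 𝔅 * (siteScale S hS hdivS lvl zc hcover q.1 : ℝ) ^ 2 *
      Real.exp (-(δ * sdist bsrc btgt (siteScale S hS hdivS lvl zc hcover) q.1 t)) * m)
    {y : UT N} (hy : sdist bsrc btgt (siteScale S hS hdivS lvl zc hcover) y x ≤ 1) (j : Cp) :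
    |f (y, j)| ≤ 𝔅 * Γ ^ 2 * Real.exp δ * (siteScale S hS hdivS lvl zc hcover x : ℝ) ^ 2 *
      Real.exp (-(δ * sdist bsrc btgt (siteScale S hS hdivS lvl zc hcover) x t)) * m := by
  set n := siteScale S hS hdivS lvl zc hcover with hn
  have hd0' : (0 : ℝ) ≤ 4 * d := by positivity
  have h1 := hsup (y, j) (by dsimp only; linarith)
  have hny0 : (0 : ℝ) ≤ n y := Nat.cast_nonneg _
  have hny : (n y : ℝ) ^ 2 ≤ (Γ * n x) ^ 2 :=
    pow_le_pow_left₀ hny0 (scale_le_on_unit_ball S hS hdivS lvl zc hcover hL e hSe hR hadd hΓ hy) 2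
  have htri : sdist bsrc btgt n x t ≤ sdist bsrc btgt n x y + sdist bsrc btgt n y t := sdist_triangle_torus n x y t
  have hsym : sdist bsrc btgt n x y = sdist bsrc btgt n y x := sdist_comm bsrc btgt n x y
  have hexp : Real.exp (-(δ * sdist bsrc btgt n y t)) ≤ Real.exp δ * Real.exp (-(δ * sdist bsrc btgt n x t)) := by
    rw [← Real.exp_add]
    refine Real.exp_le_exp.mpr ?_
    have : δ * (sdist bsrc btgt n x t - 1) ≤ δ * sdist bsrc btgt n y t := mul_le_mul_of_nonneg_left (by linarith) hδ0
    linarith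
  calc |f (y, j)| ≤ 𝔅 * (n y : ℝ) ^ 2 * Real.exp (-(δ * sdist bsrc btgt n y t)) * m := h1
    _ ≤ 𝔅 * (Γ * n x) ^ 2 * (Real.exp δ * Real.exp (-(δ * sdist bsrc btgt n x t))) * m := by gcongr
    _ = 𝔅 * Γ ^ 2 * Real.exp δ * (n x : ℝ) ^ 2 * Real.exp (-(δ * sdist bsrc btgt n x t)) * m := by ring


end Ball

section Averaging

variable [NeZero d] {Cp J K : Type} [Fintype Cp] [DecidableEq Cp] [Fintype J] [Fintype K] [DecidableEq K]
  (S : J → ℕ) (hS : ∀ l, 1 ≤ S l) (hdivS : ∀ l i, S l ∣ N i) (lvl : K → J) (zc : (k : K) → Ctr N (S (lvl k)))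
  (hdisj : ∀ k k' v v', cellPt S hS hdivS lvl zc k v = cellPt S hS hdivS lvl zc k' v' → k = k')
  (hcover : ∀ x : UT N, ∃ k, ∃ v : Box d (S (lvl k)), cellPt S hS hdivS lvl zc k v = x)
  (T : J → UT N → Cp → Cp → ℝ) (hT : ∀ l x i i', ∑ k, T l x k i * T l x k i' = if i = i' then (1 : ℝ) else 0)
  (a : J → ℝ) (ha : ∀ j, 0 ≤ a j) (ω : J → UT N → ℝ)
  (hsupp : ∀ l x, ω l (ctrU N (S l) (tblk (hS l) (hdivS l) x)) ≠ 0 → ∃ k v, lvl k = l ∧ cellPt S hS hdivS lvl zc k v = x)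
  {amax : ℝ} (hamax : 0 ≤ amax)
  (hscale : ∀ k, a (lvl k) * ω (lvl k) (ctrU N (S (lvl k)) (zc k)) ^ 2 * (S (lvl k) : ℝ) ^ d ≤ amax / (S (lvl k) : ℝ) ^ 2)

include hdisj hT ha hsupp hamax hscale


omit [Fintype K] in
/-- **(β₁, localized) THE AVERAGING PART ON THE `d_n`-BALL OF RADIUS 1, SUP CURRENCY.**  If `|f(q)| ≤ 𝔅·n(q)²·e^{−δd_n(q,t)}·m` on the `d_n`-ball of radius `4d+1` about `x` (cellmates of a point of the unit ball are within `4d+1` of `x`),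
then for `d_n(y,x) ≤ 1`, `|(Σ_l a_l G_lᵀG_l f)(y,j)| ≤ a_max·√|Cp|·𝔅·e^{δ(4d+1)}·e^{−δd_n(x,t)}·m` — 10a's (P) budget
`a_max·n(y)⁻²·√(n(y)^{−d}Σ_{cell(y)} f²)`, the cell's `n(y)^d·|Cp|` sites (`card_cellCp_le`) all within `d_n`-distance `4d` of
`y` towards `t` (`cell_in_ball`); the two powers of `n(y)` cancel exactly. [cite: Balaban1985BackgroundPropagators, (3.16) p.393] [folklore] -/
theorem abs_levelSum_le_on_unit_ball_loc {δ 𝔅 m : ℝ} (hδ0 : 0 ≤ δ) (h𝔅0 : 0 ≤ 𝔅) (hm : 0 ≤ m) (f : UT N × Cp → ℝ) (t : UT N)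
    {x : UT N}
    (hsup : ∀ q : UT N × Cp, sdist bsrc btgt (siteScale S hS hdivS lvl zc hcover) q.1 x ≤ 4 * d + 1 →
      |f q| ≤ 𝔅 * (siteScale S hS hdivS lvl zc hcover q.1 : ℝ) ^ 2 *
      Real.exp (-(δ * sdist bsrc btgt (siteScale S hS hdivS lvl zc hcover) q.1 t)) * m)
    {y : UT N} (hy : sdist bsrc btgt (siteScale S hS hdivS lvl zc hcover) y x ≤ 1) (j : Cp) :
    |levelSum (fun l x => ctrU N (S l) (tblk (hS l) (hdivS l) x)) (fun l x => ω l (ctrU N (S l) (tblk (hS l) (hdivS l) x))) T a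
        f (y, j)| ≤
      amax * Real.sqrt (Fintype.card Cp) * 𝔅 * Real.exp (δ * (4 * d + 1)) *
        Real.exp (-(δ * sdist bsrc btgt (siteScale S hS hdivS lvl zc hcover) x t)) * m := by
  classical
  set n := siteScale S hS hdivS lvl zc hcover with hn
  set ky := cellOf S hS hdivS lvl zc hcover y with hky
  set D := sdist bsrc btgt n x t with hD
  set Cl := univ.filter (fun q : UT N × Cp => cellOf S hS hdivS lvl zc hcover q.1 = ky) with hCl
  have hP := abs_levelSum_apply_le S hS hdivS lvl zc hdisj hcover T hT a ha ω hsupp hamax hscale f (y, j) ky rfl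
  have hSy : (S (lvl ky) : ℝ) = n y := by rw [hn, siteScale]
  have hny : (0 : ℝ) < n y := by exact_mod_cast one_le_siteScale S hS hdivS lvl zc hcover y
  -- every site of the cell of `y` carries `|f| ≤ Φ`
  set Φ := 𝔅 * (n y : ℝ) ^ 2 * (Real.exp (δ * (4 * d + 1)) * Real.exp (-(δ * D))) * m with hΦ
  have hΦ0 : 0 ≤ Φ := by rw [hΦ]; positivity
  have htri : D ≤ sdist bsrc btgt n x y + sdist bsrc btgt n y t := sdist_triangle_torus n x y t
  have hsym : sdist bsrc btgt n x y = sdist bsrc btgt n y x := sdist_comm bsrc btgt n x y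
  have hcell : ∀ q ∈ Cl, |f q| ≤ Φ := by
    intro q hq
    have hq' : cellOf S hS hdivS lvl zc hcover q.1 = ky := (mem_filter.mp hq).2
    have hnq : (n q.1 : ℝ) = n y := by
      rw [hn]
      show ((siteScale S hS hdivS lvl zc hcover q.1 : ℕ) : ℝ) = (siteScale S hS hdivS lvl zc hcover y : ℕ)
      rw [siteScale, siteScale, hq']
    -- `d_n(y, t) ≤ d_n(q, t) + 4d` (cellmates)
    have hcm : sdist bsrc btgt n y t ≤ sdist bsrc btgt n q.1 t + 4 * d :=
      cell_in_ball S hS hdivS lvl zc hdisj hcover (x := q.1) (x₀ := t) (q := y) (s := sdist bsrc btgt n q.1 t) le_rfl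
        (by rw [hq'])
    have hexp : Real.exp (-(δ * sdist bsrc btgt n q.1 t)) ≤ Real.exp (δ * (4 * d + 1)) * Real.exp (-(δ * D)) := by
      rw [← Real.exp_add]
      refine Real.exp_le_exp.mpr ?_
      have : δ * (D - 1 - 4 * d) ≤ δ * sdist bsrc btgt n q.1 t := mul_le_mul_of_nonneg_left (by linarith) hδ0
      linarith
    -- cellmates lie within `4d` of each other, hence within `4d + 1` of `x`
    have hqx : sdist bsrc btgt n q.1 x ≤ 4 * d + 1 := by
      have hthr := sdist_corner_thresholds S hS hdivS lvl zc hdisj hcover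
      have h1 : sdist bsrc btgt n q.1 (ctrU N (S (lvl ky)) (zc ky)) ≤ 2 * d := (hthr q.1 ky).1 hq'
      have h2 : sdist bsrc btgt n y (ctrU N (S (lvl ky)) (zc ky)) ≤ 2 * d := (hthr y ky).1 rfl
      have h3 := sdist_triangle_torus n q.1 (ctrU N (S (lvl ky)) (zc ky)) y
      have h4 := sdist_triangle_torus n q.1 y x
      rw [sdist_comm bsrc btgt n (ctrU N (S (lvl ky)) (zc ky)) y] at h3
      linarith
    calc |f q| ≤ 𝔅 * (n q.1 : ℝ) ^ 2 * Real.exp (-(δ * sdist bsrc btgt n q.1 t)) * m := hsup q hqx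
      _ ≤ 𝔅 * (n q.1 : ℝ) ^ 2 * (Real.exp (δ * (4 * d + 1)) * Real.exp (-(δ * D))) * m := by gcongr
      _ = Φ := by rw [hΦ, hnq]
  -- hence the cell's ℓ² mass is at most `n(y)^d·|Cp|·Φ²`
  have hcard : ((Cl.card : ℕ) : ℝ) ≤ (S (lvl ky) : ℝ) ^ d * Fintype.card Cp := by
    exact_mod_cast card_cellCp_le S hS hdivS lvl zc hcover ky
  have hmass : ∑ q ∈ Cl, f q ^ 2 ≤ (n y : ℝ) ^ d * Fintype.card Cp * Φ ^ 2 := by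
    calc ∑ q ∈ Cl, f q ^ 2 ≤ ∑ q ∈ Cl, Φ ^ 2 := Finset.sum_le_sum fun q hq => by
            have := hcell q hq; rw [← sq_abs]; exact pow_le_pow_left₀ (abs_nonneg _) this 2
      _ = ((Cl.card : ℕ) : ℝ) * Φ ^ 2 := by rw [Finset.sum_const, nsmul_eq_mul]
      _ ≤ (S (lvl ky) : ℝ) ^ d * Fintype.card Cp * Φ ^ 2 := mul_le_mul_of_nonneg_right hcard (sq_nonneg _)
      _ = (n y : ℝ) ^ d * Fintype.card Cp * Φ ^ 2 := by rw [hSy]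
  have hnd : (0 : ℝ) < (n y : ℝ) ^ d := pow_pos hny d
  have hsqrt : Real.sqrt (((n y : ℝ) ^ d)⁻¹ * ∑ q ∈ Cl, f q ^ 2) ≤ Real.sqrt (Fintype.card Cp) * Φ := by
    have h1 : ((n y : ℝ) ^ d)⁻¹ * ∑ q ∈ Cl, f q ^ 2 ≤ Fintype.card Cp * Φ ^ 2 := by
      calc ((n y : ℝ) ^ d)⁻¹ * ∑ q ∈ Cl, f q ^ 2 ≤ ((n y : ℝ) ^ d)⁻¹ * ((n y : ℝ) ^ d * Fintype.card Cp * Φ ^ 2) :=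
            mul_le_mul_of_nonneg_left hmass (by positivity)
        _ = Fintype.card Cp * Φ ^ 2 := by rw [← mul_assoc, ← mul_assoc, inv_mul_cancel₀ hnd.ne', one_mul]
    calc Real.sqrt (((n y : ℝ) ^ d)⁻¹ * ∑ q ∈ Cl, f q ^ 2) ≤ Real.sqrt (Fintype.card Cp * Φ ^ 2) := Real.sqrt_le_sqrt h1
      _ = Real.sqrt (Fintype.card Cp) * Φ := by rw [Real.sqrt_mul (by positivity), Real.sqrt_sq hΦ0]
  rw [hSy] at hP
  have hn2 : (0 : ℝ) < (n y : ℝ) ^ 2 := pow_pos hny 2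
  calc |levelSum (fun l x => ctrU N (S l) (tblk (hS l) (hdivS l) x)) (fun l x => ω l (ctrU N (S l) (tblk (hS l) (hdivS l) x)))
          T a f (y, j)|
        ≤ amax * ((n y : ℝ) ^ 2)⁻¹ * Real.sqrt (((n y : ℝ) ^ d)⁻¹ * ∑ q ∈ Cl, f q ^ 2) := hP
    _ ≤ amax * ((n y : ℝ) ^ 2)⁻¹ * (Real.sqrt (Fintype.card Cp) * Φ) := mul_le_mul_of_nonneg_left hsqrt (by positivity)
    _ = amax * Real.sqrt (Fintype.card Cp) * 𝔅 * Real.exp (δ * (4 * d + 1)) * Real.exp (-(δ * D)) * m *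
          (((n y : ℝ) ^ 2)⁻¹ * (n y : ℝ) ^ 2) := by rw [hΦ]; ring
    _ = amax * Real.sqrt (Fintype.card Cp) * 𝔅 * Real.exp (δ * (4 * d + 1)) * Real.exp (-(δ * D)) * m := by
          rw [inv_mul_cancel₀ hn2.ne', mul_one]


end Averaging

end

end Summit.QuantumFields.BalabanUV.Beta.MultiscaleGradientSourceLocal
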